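import Summits.CriticalPhenomena.CardyFormulaZ2.Theorems.CardyUSTContinuationKirchhoffExtremalLengthCounting
import Summits.CriticalPhenomena.CardyFormulaZ2.Theorems.CardyUSTContinuationKirchhoffExtremalLengthBushTree

/-!
# Kirchhoff's theorem for the UST limit of the jointly wired FK model, V: the theorem

Support file for `KirchhoffExtremalLength` (route CardyUSTContinuation of `CardyFormulaZ2`, item
stmt-CriticalPhenomena-11234): for disjoint vertex sets `B₁, B₂` of a finite graph with unit
conductances, `[t^{m+1}] N / [t^m] Z^joint = 𝒞(B₁ ↔ B₂)`, where `Z^joint(t) = Σ_ω t^{|ω|+2k(ω)}`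
(the two sets wired jointly), `N` its crossing-restricted part and `m = ord₀ Z^joint`
(`coeff_div_coeff_eq_toReal_effectiveConductance`): the Kirchhoff slope of the self-dual FK
crossing probability (`KirchhoffSlope.eventually_tendsto_crossingProb_div`) is the effective
conductance between the discrete arcs (Kirchhoff 1847; Lyons–Peres 2016 §4.2; Grimmett 2006
Thm 1.23 for the `q ↓ 0` limit). Proof: the tree-count potential, its Laplacian as the net count of
traversed edges (`laplacian_pot_eq`), parts I–IV, and Dirichlet's principle.
-/

noncomputable section

namespace Summit.CriticalPhenomena.CardyFormulaZ2.Theorems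

namespace KirchhoffSlope

open Finset SimpleGraph
open Literature.Probability.LatticeModels Literature.Probability.Percolation

variable {V : Type*} [DecidableEq V]

/-! ### §10. The tree-count potential and Kirchhoff's theorem -/

/-- Pulling a finite sum out of a conditional. [folklore] -/
theorem ite_sum_zero {ι : Type*} (s : Finset ι) (p : Prop) [Decidable p] (f : ι → ℝ) :
    (if p then ∑ i ∈ s, f i else 0) = ∑ i ∈ s, (if p then f i else 0) := by
  split_ifs <;> simp

/-- Exchanging a sum of cardinalities of filters. [folklore] -/
theorem sum_card_filter_comm {α β : Type*} [Fintype β] (s : Finset α) (R : α → Prop) [DecidablePred R]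
    (Q : β → α → Prop) [∀ w, DecidablePred (Q w)] :
    ∑ w, #(s.filter fun x => R x ∧ Q w x) = ∑ x ∈ s.filter R, #(Finset.univ.filter fun w => Q w x) := by
  simp only [Finset.card_filter]
  rw [Finset.sum_comm, Finset.sum_filter]
  refine Finset.sum_congr rfl fun x _ => ?_
  by_cases hR : R x
  · simp [hR]
  · simp [hR]

section Kirchhoff

open scoped ENNReal NNReal

variable [Fintype V] {G : SimpleGraph V} [DecidableRel G.Adj] {m : ℕ} {B₁ B₂ : Set V}

omit [DecidableEq V] in
open scoped Classical in
/-- Potential differences of the tree-count potential `N(z) = #{minimisers rooting z in B₁}`: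
`N(z) - N(w) = #{ω : z rooted, w not} - #{ω : w rooted, z not}`. [folklore] -/
theorem pot_sub_pot (z w : V) :
    (#(G.edgeFinset.powerset.filter fun ω =>
        #ω + 2 * clusterCount (↑ω : BondConfig V) (B₁ ∪ B₂) = m ∧
        ∃ a ∈ B₁, (openGraph (↑ω : BondConfig V)).Reachable z a) : ℝ) -
      #(G.edgeFinset.powerset.filter fun ω =>
        #ω + 2 * clusterCount (↑ω : BondConfig V) (B₁ ∪ B₂) = m ∧
        ∃ a ∈ B₁, (openGraph (↑ω : BondConfig V)).Reachable w a) =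
    (#(G.edgeFinset.powerset.filter fun ω =>
        #ω + 2 * clusterCount (↑ω : BondConfig V) (B₁ ∪ B₂) = m ∧
        (∃ a ∈ B₁, (openGraph (↑ω : BondConfig V)).Reachable z a) ∧
        ¬ ∃ a ∈ B₁, (openGraph (↑ω : BondConfig V)).Reachable w a) : ℝ) -
      #(G.edgeFinset.powerset.filter fun ω =>
        #ω + 2 * clusterCount (↑ω : BondConfig V) (B₁ ∪ B₂) = m ∧
        (∃ a ∈ B₁, (openGraph (↑ω : BondConfig V)).Reachable w a) ∧
        ¬ ∃ a ∈ B₁, (openGraph (↑ω : BondConfig V)).Reachable z a) := by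
  set S := G.edgeFinset.powerset with hS
  set Cz : Finset (Sym2 V) → Prop := fun ω => ∃ a ∈ B₁, (openGraph (↑ω : BondConfig V)).Reachable z a with hCz
  set Cw : Finset (Sym2 V) → Prop := fun ω => ∃ a ∈ B₁, (openGraph (↑ω : BondConfig V)).Reachable w a with hCw
  set Em : Finset (Sym2 V) → Prop := fun ω => #ω + 2 * clusterCount (↑ω : BondConfig V) (B₁ ∪ B₂) = m with hEm
  have hz : #(S.filter fun ω => Em ω ∧ Cz ω) =
      #(S.filter fun ω => Em ω ∧ Cz ω ∧ Cw ω) + #(S.filter fun ω => Em ω ∧ Cz ω ∧ ¬ Cw ω) := by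
    rw [← Finset.card_filter_add_card_filter_not (p := fun ω => Cw ω), Finset.filter_filter,
      Finset.filter_filter]
    congr 2 <;> (ext ω; simp only [Finset.mem_filter]; tauto)
  have hw : #(S.filter fun ω => Em ω ∧ Cw ω) =
      #(S.filter fun ω => Em ω ∧ Cz ω ∧ Cw ω) + #(S.filter fun ω => Em ω ∧ Cw ω ∧ ¬ Cz ω) := by
    rw [← Finset.card_filter_add_card_filter_not (p := fun ω => Cz ω), Finset.filter_filter,
      Finset.filter_filter]
    congr 2 <;> (ext ω; simp only [Finset.mem_filter]; tauto)
  change (#(S.filter fun ω => Em ω ∧ Cz ω) : ℝ) - #(S.filter fun ω => Em ω ∧ Cw ω) =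
    (#(S.filter fun ω => Em ω ∧ Cz ω ∧ ¬ Cw ω) : ℝ) - #(S.filter fun ω => Em ω ∧ Cw ω ∧ ¬ Cz ω)
  rw [hz, hw]
  push_cast
  ring

open scoped Classical in
/-- **The Laplacian of the tree-count potential is the net count of traversed edges**:
`Σ_{w ∼ z} (N(z) - N(w)) = Σ_{ω' ∈ 𝒩} (#out(z, ω') - #in(z, ω'))` over the crossing
configurations `𝒩` of exponent `m + 1` (bush–tree correspondence). [folklore] -/
theorem laplacian_pot_eq
    (hm : ∀ ω ⊆ G.edgeFinset, m ≤ #ω + 2 * clusterCount (↑ω : BondConfig V) (B₁ ∪ B₂)) (z : V) :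
    ∑ w, (if G.Adj z w then ((1 : Sym2 V → ℝ≥0) s(z, w) : ℝ) *
      ((#(G.edgeFinset.powerset.filter fun ω =>
        #ω + 2 * clusterCount (↑ω : BondConfig V) (B₁ ∪ B₂) = m ∧
        ∃ a ∈ B₁, (openGraph (↑ω : BondConfig V)).Reachable z a) : ℝ) -
      #(G.edgeFinset.powerset.filter fun ω =>
        #ω + 2 * clusterCount (↑ω : BondConfig V) (B₁ ∪ B₂) = m ∧
        ∃ a ∈ B₁, (openGraph (↑ω : BondConfig V)).Reachable w a)) else 0) =
    ∑ ω' ∈ G.edgeFinset.powerset.filter (fun ω' =>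
        #ω' + 2 * clusterCount (↑ω' : BondConfig V) (B₁ ∪ B₂) = m + 1 ∧
        ∃ a ∈ B₁, ∃ b ∈ B₂, (openGraph (↑ω' : BondConfig V)).Reachable a b),
      ((#(Finset.univ.filter fun w => s(z, w) ∈ ω' ∧
        #(ω'.erase s(z, w)) + 2 * clusterCount (↑(ω'.erase s(z, w)) : BondConfig V) (B₁ ∪ B₂) = m ∧
        (∃ a ∈ B₁, (openGraph (↑(ω'.erase s(z, w)) : BondConfig V)).Reachable z a) ∧
        ¬ ∃ a ∈ B₁, (openGraph (↑(ω'.erase s(z, w)) : BondConfig V)).Reachable w a) : ℝ) -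
      #(Finset.univ.filter fun w => s(w, z) ∈ ω' ∧
        #(ω'.erase s(w, z)) + 2 * clusterCount (↑(ω'.erase s(w, z)) : BondConfig V) (B₁ ∪ B₂) = m ∧
        (∃ a ∈ B₁, (openGraph (↑(ω'.erase s(w, z)) : BondConfig V)).Reachable w a) ∧
        ¬ ∃ a ∈ B₁, (openGraph (↑(ω'.erase s(w, z)) : BondConfig V)).Reachable z a)) := by
  have hB₁ : B₁ ⊆ B₁ ∪ B₂ := Set.subset_union_left
  have hW : B₁ ∪ B₂ ⊆ B₁ ∪ B₂ := subset_rfl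
  set S := G.edgeFinset.powerset with hS
  -- abbreviations
  set R : Finset (Sym2 V) → Prop := fun ω' =>
    #ω' + 2 * clusterCount (↑ω' : BondConfig V) (B₁ ∪ B₂) = m + 1 ∧
    ∃ a ∈ B₁, ∃ b ∈ B₂, (openGraph (↑ω' : BondConfig V)).Reachable a b with hR
  set P : V → V → Finset (Sym2 V) → Prop := fun x y ω' => s(x, y) ∈ ω' ∧
        #(ω'.erase s(x, y)) + 2 * clusterCount (↑(ω'.erase s(x, y)) : BondConfig V) (B₁ ∪ B₂) = m ∧
        (∃ a ∈ B₁, (openGraph (↑(ω'.erase s(x, y)) : BondConfig V)).Reachable x a) ∧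
        ¬ ∃ a ∈ B₁, (openGraph (↑(ω'.erase s(x, y)) : BondConfig V)).Reachable y a with hP
  -- termwise: bush–tree correspondence
  have step1 : ∀ w, (if G.Adj z w then ((1 : Sym2 V → ℝ≥0) s(z, w) : ℝ) *
      ((#(S.filter fun ω =>
        #ω + 2 * clusterCount (↑ω : BondConfig V) (B₁ ∪ B₂) = m ∧
        ∃ a ∈ B₁, (openGraph (↑ω : BondConfig V)).Reachable z a) : ℝ) -
      #(S.filter fun ω =>
        #ω + 2 * clusterCount (↑ω : BondConfig V) (B₁ ∪ B₂) = m ∧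
        ∃ a ∈ B₁, (openGraph (↑ω : BondConfig V)).Reachable w a)) else 0) =
      (#(S.filter fun ω' => R ω' ∧ P z w ω') : ℝ) - #(S.filter fun ω' => R ω' ∧ P w z ω') := by
    intro w
    by_cases h : G.Adj z w
    · rw [if_pos h, Pi.one_apply, NNReal.coe_one, one_mul, pot_sub_pot,
        card_bush_eq_card_tree hm hB₁ hW h, card_bush_eq_card_tree hm hB₁ hW h.symm]
    · rw [if_neg h]
      have e1 : (S.filter fun ω' => R ω' ∧ P z w ω') = ∅ := by
        refine Finset.filter_eq_empty_iff.2 fun ω' hω' hQ => h ?_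
        exact mem_edgeFinset.1 (Finset.mem_powerset.1 hω' hQ.2.1)
      have e2 : (S.filter fun ω' => R ω' ∧ P w z ω') = ∅ := by
        refine Finset.filter_eq_empty_iff.2 fun ω' hω' hQ => h ?_
        exact (mem_edgeFinset.1 (Finset.mem_powerset.1 hω' hQ.2.1)).symm
      rw [e1, e2, Finset.card_empty]
      simp
  rw [Finset.sum_congr rfl fun w _ => step1 w, Finset.sum_sub_distrib]
  have h1' : (∑ w, (#(S.filter fun ω' => R ω' ∧ P z w ω') : ℝ)) =
      ∑ x ∈ S.filter R, (#(Finset.univ.filter fun w => P z w x) : ℝ) := by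
    simpa [Nat.cast_sum] using congrArg (Nat.cast (R := ℝ)) (sum_card_filter_comm S R (fun w ω' => P z w ω'))
  have h2' : (∑ w, (#(S.filter fun ω' => R ω' ∧ P w z ω') : ℝ)) =
      ∑ x ∈ S.filter R, (#(Finset.univ.filter fun w => P w z x) : ℝ) := by
    simpa [Nat.cast_sum] using congrArg (Nat.cast (R := ℝ)) (sum_card_filter_comm S R (fun w ω' => P w z ω'))
  rw [h1', h2', ← Finset.sum_sub_distrib]

omit [DecidableEq V] in
/-- The coefficient of `t^j` of `Z^w_G = Σ_ω t^{|ω| + 2k^w(ω)}` counts the configurations of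
exponent `j`. [folklore] -/
theorem coeff_rcArcPolynomial_eq_card (B₁ B₂ : Set V) (w : ArcWiring) (j : ℕ) :
    open scoped Classical in
    (rcArcPolynomial G B₁ B₂ w).coeff j =
      #(G.edgeFinset.powerset.filter fun ω => #ω + 2 * arcClusterCount (↑ω : BondConfig V) B₁ B₂ w = j) := by
  classical
  rw [rcArcPolynomial, Polynomial.finsetSum_coeff, Finset.card_filter]
  refine Finset.sum_congr rfl fun ω _ => ?_
  rw [Polynomial.coeff_X_pow]
  by_cases h : #ω + 2 * arcClusterCount (↑ω : BondConfig V) B₁ B₂ w = j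
  · rw [if_pos h.symm, if_pos h]
  · rw [if_neg (Ne.symm h), if_neg h]

omit [DecidableEq V] in
/-- The coefficient of `t^j` of the restricted polynomial `N^w_{G,U}` counts the configurations
in `U` of exponent `j`. [folklore] -/
theorem coeff_rcArcPolynomialIn_eq_card (U : Set (BondConfig V)) (B₁ B₂ : Set V) (w : ArcWiring) (j : ℕ) :
    open scoped Classical in
    (rcArcPolynomialIn G U B₁ B₂ w).coeff j =
      #(G.edgeFinset.powerset.filter fun ω => #ω + 2 * arcClusterCount (↑ω : BondConfig V) B₁ B₂ w = j ∧
        (↑ω : BondConfig V) ∈ U) := by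
  classical
  rw [rcArcPolynomialIn, Polynomial.finsetSum_coeff, ← Finset.filter_filter, Finset.filter_comm,
    Finset.card_filter]
  refine Finset.sum_congr rfl fun ω _ => ?_
  rw [Polynomial.coeff_X_pow]
  by_cases h : #ω + 2 * arcClusterCount (↑ω : BondConfig V) B₁ B₂ w = j
  · rw [if_pos h.symm, if_pos h]
  · rw [if_neg (Ne.symm h), if_neg h]

/-- **Kirchhoff's theorem for the uniform-spanning-tree limit of the jointly wired FK model.**
For disjoint vertex sets `B₁, B₂` of a finite graph with unit conductances, with
`Z(t) = Σ_ω t^{|ω| + 2 k^{B₁ ∪ B₂}(ω)}` (`rcArcPolynomial … .joint`), `N(t)` its restriction to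
the configurations joining `B₁` to `B₂` by an open path, and `m = ord₀ Z`:
`[t^{m+1}] N / [t^m] Z = 𝒞(B₁ ↔ B₂)`, the effective conductance between `B₁` and `B₂`
(= #spanning trees of `G` with `B₁`, `B₂` contracted separately / #spanning trees with
`B₁ ∪ B₂` contracted; Kirchhoff 1847, Lyons–Peres 2016 §4.2, Grimmett 2018 Thm 1.16). Proof:
the tree-count potential `N(z) = #{minimisers rooting z in B₁}` equals `#𝒮` on `B₁`, `0` on `B₂`,
and its Laplacian is the net number of traversed edges at `z` over the `#𝒩` crossing
configurations of exponent `m + 1` (`laplacian_pot_eq`), which vanishes off `B₁ ∪ B₂`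
(`card_traversed_out_eq_card_traversed_in`) and sums to `#𝒩` over `B₁`
(`sum_card_traversed_out_eq_one`); conclude by Dirichlet's principle
(`effectiveConductance_eq_of_harmonic_sets`). [cite: LyonsPeres2016, §4.2] -/
theorem coeff_div_coeff_eq_toReal_effectiveConductance (B₁ B₂ : Set V) (hdisj : Disjoint B₁ B₂) :
    ((rcArcPolynomialIn G (arcCrossing B₁ B₂) B₁ B₂ .joint).coeff
        ((rcArcPolynomial G B₁ B₂ .joint).natTrailingDegree + 1) : ℝ) /
      ((rcArcPolynomial G B₁ B₂ .joint).coeff (rcArcPolynomial G B₁ B₂ .joint).natTrailingDegree : ℝ) =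
    (effectiveConductance G 1 B₁ B₂).toReal := by
  classical
  set m := (rcArcPolynomial G B₁ B₂ .joint).natTrailingDegree with hmdef
  have hB₁ : B₁ ⊆ B₁ ∪ B₂ := Set.subset_union_left
  have hB₂ : B₂ ⊆ B₁ ∪ B₂ := Set.subset_union_right
  have hW : B₁ ∪ B₂ ⊆ B₁ ∪ B₂ := subset_rfl
  have hm : ∀ ω ⊆ G.edgeFinset, m ≤ #ω + 2 * clusterCount (↑ω : BondConfig V) (B₁ ∪ B₂) :=
    fun ω hω => natTrailingDegree_le_exponent G B₁ B₂ .joint hω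
  set S := G.edgeFinset.powerset with hS
  set 𝒮 := S.filter fun ω => #ω + 2 * clusterCount (↑ω : BondConfig V) (B₁ ∪ B₂) = m with h𝒮
  set 𝒩 := S.filter fun ω' => #ω' + 2 * clusterCount (↑ω' : BondConfig V) (B₁ ∪ B₂) = m + 1 ∧
    ∃ a ∈ B₁, ∃ b ∈ B₂, (openGraph (↑ω' : BondConfig V)).Reachable a b with h𝒩
  -- the two coefficients
  have hZ : (rcArcPolynomial G B₁ B₂ .joint).coeff m = #𝒮 := coeff_rcArcPolynomial_eq_card B₁ B₂ .joint m
  have hN : (rcArcPolynomialIn G (arcCrossing B₁ B₂) B₁ B₂ .joint).coeff (m + 1) = #𝒩 := by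
    rw [coeff_rcArcPolynomialIn_eq_card]
    congr 1
    ext ω
    simp only [Finset.mem_filter, mem_arcCrossing_iff, arcClusterCount_joint, h𝒩]
    rfl
  have h𝒮pos : 0 < #𝒮 := by
    rw [← hZ]
    exact Nat.pos_of_ne_zero (Polynomial.trailingCoeff_nonzero_iff_nonzero.2 (rcArcPolynomial_ne_zero G B₁ B₂ _))
  -- the potential
  set N : V → ℝ := fun z => #(S.filter fun ω =>
    #ω + 2 * clusterCount (↑ω : BondConfig V) (B₁ ∪ B₂) = m ∧
    ∃ a ∈ B₁, (openGraph (↑ω : BondConfig V)).Reachable z a) with hNdef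
  have hNA : ∀ x ∈ B₁, N x = #𝒮 := by
    intro x hx
    simp only [hNdef, h𝒮]
    congr 2
    refine Finset.filter_congr fun ω _ => ⟨fun h => h.1, fun h => ⟨h, x, hx, Reachable.refl _⟩⟩
  have hNZ : ∀ y ∈ B₂, N y = 0 := by
    intro y hy
    simp only [hNdef, Nat.cast_eq_zero, Finset.card_eq_zero]
    refine Finset.filter_eq_empty_iff.2 fun ω hω h => ?_
    obtain ⟨a, ha, hya⟩ := h.2
    exact not_reachable_of_minimal hm (Finset.mem_powerset.1 hω) h.1 (hB₂ hy) (hB₁ ha)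
      (hdisj.ne_of_mem ha hy).symm hya
  have key := effectiveConductance_eq_of_harmonic_sets G (1 : Sym2 V → ℝ≥0) (A := B₁) (Z := B₂) N
    (D := #𝒮) (Tw := #𝒩) (by exact_mod_cast h𝒮pos) hNA hNZ ?_ ?_
  · rw [key, ENNReal.toReal_ofReal (by positivity), hZ, hN]
  · -- harmonic off `B₁ ∪ B₂`
    intro z hz₁ hz₂
    rw [laplacian_pot_eq hm z]
    refine Finset.sum_eq_zero fun ω' hω' => ?_
    rw [Finset.mem_filter, Finset.mem_powerset] at hω'
    rw [sub_eq_zero]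
    exact_mod_cast card_traversed_out_eq_card_traversed_in hm hω'.1 hω'.2.1 hB₁ hB₂ hW hdisj hω'.2.2
      (fun h => h.elim hz₁ hz₂)
  · -- total flux out of `B₁`
    conv_lhs => enter [2, z]; rw [laplacian_pot_eq hm z, ite_sum_zero]
    rw [Finset.sum_comm]
    have hone : ∀ ω' ∈ 𝒩, ∑ z, (if z ∈ B₁ then
        ((#(Finset.univ.filter fun w => s(z, w) ∈ ω' ∧
          #(ω'.erase s(z, w)) + 2 * clusterCount (↑(ω'.erase s(z, w)) : BondConfig V) (B₁ ∪ B₂) = m ∧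
          (∃ a ∈ B₁, (openGraph (↑(ω'.erase s(z, w)) : BondConfig V)).Reachable z a) ∧
          ¬ ∃ a ∈ B₁, (openGraph (↑(ω'.erase s(z, w)) : BondConfig V)).Reachable w a) : ℝ) -
        #(Finset.univ.filter fun w => s(w, z) ∈ ω' ∧
          #(ω'.erase s(w, z)) + 2 * clusterCount (↑(ω'.erase s(w, z)) : BondConfig V) (B₁ ∪ B₂) = m ∧
          (∃ a ∈ B₁, (openGraph (↑(ω'.erase s(w, z)) : BondConfig V)).Reachable w a) ∧
          ¬ ∃ a ∈ B₁, (openGraph (↑(ω'.erase s(w, z)) : BondConfig V)).Reachable z a)) else 0) = 1 := by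
      intro ω' hω'
      rw [Finset.mem_filter, Finset.mem_powerset] at hω'
      have h1 := sum_card_traversed_out_eq_one hm hω'.1 hω'.2.1 hB₁ hB₂ hW hdisj hω'.2.2
      have h1' : (∑ a, (if a ∈ B₁ then (#(Finset.univ.filter fun w => s(a, w) ∈ ω' ∧
          #(ω'.erase s(a, w)) + 2 * clusterCount (↑(ω'.erase s(a, w)) : BondConfig V) (B₁ ∪ B₂) = m ∧
          (∃ a' ∈ B₁, (openGraph (↑(ω'.erase s(a, w)) : BondConfig V)).Reachable a a') ∧
          ¬ ∃ a' ∈ B₁, (openGraph (↑(ω'.erase s(a, w)) : BondConfig V)).Reachable w a') : ℝ) else 0)) = 1 := by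
        exact_mod_cast h1
      rw [← h1']
      refine Finset.sum_congr rfl fun z _ => ?_
      by_cases hz : z ∈ B₁
      · rw [if_pos hz, if_pos hz, traversed_in_eq_empty hz, Finset.card_empty, Nat.cast_zero, sub_zero]
      · rw [if_neg hz, if_neg hz]
    rw [Finset.sum_congr rfl hone, Finset.sum_const, nsmul_eq_mul, mul_one]

end Kirchhoff

end KirchhoffSlope

end Summit.CriticalPhenomena.CardyFormulaZ2.Theorems
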